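import Summits.CriticalPhenomena.SAWScalingLimit.Theorems.SAWTotalPositivityCriticalBubbleBoundJoinDefs

/-!
# Line `docking-census-joining` for the crux `SAWTotalPositivity.CriticalBubbleBound`
(stmt-CriticalPhenomena-7117), JOIN-MASS programme: non-touching sub-families of lattice sites

Stub `exists_nonTouching_subset` of the lead's skeleton (c6, join-mass wave 2). Proposition 4.5 of
Hammond (Ann. Probab. 46 (2018), arXiv:1808.09032 §4) detours around several global join plaquettes
at once; two TOUCHING plaquettes (lower-left corners at `ℓ∞`-distance `≤ 1`) would give colliding
detours, so the programme restricts to pairwise NON-TOUCHING sub-families, losing a factor `9`.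

This file is the pure combinatorial extraction: every finite family `G` of sites of `ℤ²` contains a
sub-family `S` whose members are pairwise at `ℓ∞`-distance `≥ 2` and with `#G ≤ 9 · #S` (greedy:
pick a site, discard the `≤ 9` sites of `G` in the `3 × 3` block around it, recurse).
-/

noncomputable section

open Literature.Probability.LatticeModels
open Literature.Probability.RandomPlanarGeometry Literature.Probability.RandomPlanarGeometry.SAW
open scoped BigOperators
open Summit.CriticalPhenomena.SAWScalingLimit.Theorems.CriticalBubbleBound.Negative (e₀)
open Summit.CriticalPhenomena.SAWScalingLimit.Theorems.CriticalBubbleBound.Docking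

namespace Summit.CriticalPhenomena.SAWScalingLimit.Theorems.CriticalBubbleBound.Join

/-- The sites of a family `G ⊆ ℤ²` lying in the `3 × 3` block around a site `q` (i.e. at
`ℓ∞`-distance `≤ 1` from `q`) number at most `9`: they inject into `[-1, 1]² ⊆ ℤ²` under
`q' ↦ (q 0 - q' 0, q 1 - q' 1)`. [folklore] -/
private theorem card_filter_touching_le_nine (G : Finset (Site 2)) (q : Site 2) :
    (G.filter fun q' => |q 0 - q' 0| ≤ 1 ∧ |q 1 - q' 1| ≤ 1).card ≤ 9 := by
  have h9 : (Finset.Icc (-1 : ℤ) 1 ×ˢ Finset.Icc (-1 : ℤ) 1).card = 9 := by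
    rw [Finset.card_product, Int.card_Icc]; rfl
  rw [← h9]
  refine Finset.card_le_card_of_injOn (fun q' => (q 0 - q' 0, q 1 - q' 1)) ?_ ?_
  · intro q' hq'
    simp only [Finset.coe_filter, Set.mem_setOf_eq] at hq'
    obtain ⟨-, h0, h1⟩ := hq'
    simp only [Finset.coe_product, Finset.coe_Icc, Set.mem_prod, Set.mem_Icc]
    exact ⟨abs_le.mp h0, abs_le.mp h1⟩
  · intro a _ b _ hab
    simp only [Prod.mk.injEq] at hab
    obtain ⟨h0, h1⟩ := hab
    funext i
    fin_cases i
    · change a 0 = b 0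
      omega
    · change a 1 = b 1
      omega

/-- GREEDY NON-TOUCHING EXTRACTION: every finite family `G` of sites of `ℤ²` contains a sub-family
`S ⊆ G` whose members are pairwise at `ℓ∞`-distance `≥ 2` (non-touching `3 × 3`-block centres, i.e.
`2 ≤ |q 0 - q' 0| ∨ 2 ≤ |q 1 - q' 1|` for `q ≠ q'` in `S`) and which captures at least a ninth of `G`,
`#G ≤ 9 · #S`. Proof: strong induction on `G`; pick `q ∈ G`, remove the `≤ 9` sites of `G` in the
`3 × 3` block around `q`, recurse on the rest and add `q`. [folklore] -/
theorem exists_nonTouching_subset : ∀ G : Finset (Site 2), ∃ S ⊆ G, (∀ q ∈ S, ∀ q' ∈ S, q ≠ q' → 2 ≤ |q 0 - q' 0| ∨ 2 ≤ |q 1 - q' 1|) ∧ G.card ≤ 9 * S.card := by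
  intro G
  induction G using Finset.strongInduction with
  | H G ih =>
    rcases G.eq_empty_or_nonempty with rfl | ⟨q, hq⟩
    · exact ⟨∅, Finset.empty_subset _, by simp, by simp⟩
    · -- the sites of `G` touching `q` (the `3 × 3` block around `q`, `q` included)
      set N : Finset (Site 2) := G.filter fun q' => |q 0 - q' 0| ≤ 1 ∧ |q 1 - q' 1| ≤ 1 with hN
      have hqN : q ∈ N := by simp [hN, hq]
      have hNG : N ⊆ G := Finset.filter_subset _ _
      have hN9 : N.card ≤ 9 := card_filter_touching_le_nine G q
      obtain ⟨S', hS'G, hS'sep, hS'card⟩ := ih (G \ N) (Finset.sdiff_ssubset hNG ⟨q, hqN⟩)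
      have hqS' : q ∉ S' := fun h => (Finset.mem_sdiff.mp (hS'G h)).2 hqN
      -- members of `S'` lie outside the block around `q`
      have hfar : ∀ q' ∈ S', 2 ≤ |q 0 - q' 0| ∨ 2 ≤ |q 1 - q' 1| := by
        intro q' hq'
        have hq'GN := Finset.mem_sdiff.mp (hS'G hq')
        have hnot : ¬(|q 0 - q' 0| ≤ 1 ∧ |q 1 - q' 1| ≤ 1) := fun h =>
          hq'GN.2 (Finset.mem_filter.mpr ⟨hq'GN.1, h⟩)
        rcases not_and_or.mp hnot with h0 | h1
        · exact Or.inl (by omega)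
        · exact Or.inr (by omega)
      refine ⟨insert q S', ?_, ?_, ?_⟩
      · exact Finset.insert_subset hq fun x hx => (Finset.mem_sdiff.mp (hS'G hx)).1
      · intro a ha b hb hab
        rcases Finset.mem_insert.mp ha with rfl | ha'
        · rcases Finset.mem_insert.mp hb with rfl | hb'
          · exact absurd rfl hab
          · exact hfar b hb'
        · rcases Finset.mem_insert.mp hb with rfl | hb'
          · rcases hfar a ha' with h0 | h1
            · exact Or.inl (by rwa [abs_sub_comm])
            · exact Or.inr (by rwa [abs_sub_comm])
          · exact hS'sep a ha' b hb' hab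
      · rw [Finset.card_insert_of_notMem hqS']
        have hsplit : (G \ N).card + N.card = G.card := Finset.card_sdiff_add_card_eq_card hNG
        omega

end Summit.CriticalPhenomena.SAWScalingLimit.Theorems.CriticalBubbleBound.Join

end
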